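import Summits.QuantumFields.BalabanUV.Beta.GAN24.ContactLambdaEntryBound
import Summits.QuantumFields.BalabanUV.Beta.GAN24.BornLambdaContactCells

/-!
# `GAN24.BornLambdaContactLineage` — CT-ROUTE, the row owner's `gen20/BORNSEC-PLAN-v1.md` v1.1 §0 (c)∕§0′ ∕ §A (Λ-C) **(C4) PART 4: ONE Λ LINEAGE AT `d = 3` — THE UNIT COUNT**:
# PART 3's entry bound `ContactLambdaEntryBound.abs_contact_entry_le` at the lineage legs `T_i = legChain (respStepBmSeq ρ Lc) i n`, `B_i = respStep (Lc^i) (Lc^{i+n+1})`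
# (`n + 1 = k − i` levels), the route's gauge staircase (`ContactGaugeStaircase.gauge_eq_staircase` ∕ `abs_gaugePiece_le`), a born Λ-coefficient family under UNIFORM letters
# (decay, transversality, bracket `T_b·(Lc^n)^{−7}`), times the weight `(cE·Lc^8)^{n+1}` at the pin `|cE| ≤ Lc^4`:
# `|(cE·Lc^8)^{n+1}·(push₃ T³ S − push₃ B³ S)(x, z, a, b)| ≤ C_fin·(n+1)·Lc^{−(n+1)}·e^{−(κ∕48)(|x−u′|₁ + |z−u′|₁)}` — the owner's count `(k−i)·N^{D−5}` at `D = 4` with every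
# letter a tree name, and the `inr` entries vanishing (`Push3.isFF_push₃`)  (OWNER gan24-p1-g21 [GAN24P1-G21-ONLINE] (W1); journal `CLAIMS.log` l.34168 ∕ l.34465)

HONEST FRAMING (cell charter, verbatim): «discharging `BetaPertH` makes Bałaban's UV stability UNCONDITIONAL — a real constructive-QFT result;
it is NOT the continuum limit and NOT the Clay problem.»  DERIVED cell leaf (pub-balaban, G-an2-4 formalisation swarm → CRUX TEAM (2), seat
`b2b-balaban-gan24-formalise-leaf-02`, gen 49): NOT IN PRINT — OUR PROOF ATTEMPT of one count ([folklore] bookkeeping + elementary power algebra) over PART 3, leaf-01's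
`ContactGaugeStaircase`, `BornLambdaLineage.legChain_sub_respStep_of_lt`-type data taken as HYPOTHESES with explicit constants (the letters are discharged in PART 5
`BornLambdaContactBound`); NO cited fact, NO `def`, NO `def … : Prop`, NO sorry, NO wall binder.  Discharges NO letter of (CONV-C) by itself; NEVER «G-an2-4 closed»; NOT hS0,
NOT D1, NOT `BetaPertH`, NOT continuum, NOT Clay.
HONEST DEPENDENCY (cell records, verbatim): «continuum YM on T⁴ ⇐ BetaPertH ∧ nine spine estimates (0/9 proved); BetaPertH ⇐ (D1) ∧ (D4) ∧ CAP+tail;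
G-an2-4 gates asym, D1 and NE2/3/4.»
ABSOLUTE RULE (cell charter, verbatim): «No internally-minted statement may enter as a cited fact. Every hypothesis is either kernel-proved in this
package or a verbatim quotation of a PUBLISHED theorem with page reference. The manuscript(s) under audit are NOT citable for their own disputed steps —
they are the thing under adjudication; programme-internal (2001/route/tribunal) claims are never citable.»

## What is proved (`d = 3`, `2 ≤ Lc`, in-block root `ρ = toSite rr`; letters as hypotheses with EXPLICIT constants: (N1) `C₁, κ₁`, dressed envelope `K_E, κ_E`, gauge sup `C_λ`,
## coefficient decay `C_c, δ_c`, bracket `T_b` at rate `δ_K`; common rate `κ = min δ_K κ₁`)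
* §1 power algebra: `units_le` (`|cE·Lc^8|^{n+1}·((Lc^n)^7)⁻¹·((Lc^{5(n+1)})⁻¹)²·(Lc^n)^4 ≤ Lc^3·(Lc⁻¹)^{n+1}` at `|cE| ≤ Lc^4`, with equality at the pin), `polyS_le` (the cell polynomial
  `2K_B(4α_g + 2α_g Lc n) + (8α_g² + 12α_g² Lc n) ≤ C₁²·(Lc^{5(n+1)})^{−2}·(n+1)·Lc·(64 + 544Lc + 768Lc²)`).
* §2 **`abs_weight_mul_contact_le_three`**: for ALL `κ′ u′ x z a b`,
  `|(cE·Lc^8)^{n+1}·(push₃ T_i T_i T_i (SLam Lc c H_ρ) κ′u′ − push₃ B_i B_i B_i (SLam Lc c H_ρ) κ′u′) x z a b| ≤ C_fin·((n+1)·(Lc⁻¹)^{n+1})·e^{−(κ∕48)(|x−u′|₁ + |z−u′|₁)}` with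
  `C_fin = Lc^3·(2Lc^4)⁻¹·4·T_b·e^{16κ}·Cnt·Zl(κ∕16)·C₁²·Lc·(64 + 544Lc + 768Lc²)` (`Cnt = (2Lc)^4·4·Lc^4·ell 4 Lc`) — i.e. the `LocStencil` letter `C·(k−i)^1·θ^{k−i}`, `θ = Lc⁻¹`,
  of `BornLambdaLettersPoly.exists_hBLam_of_polyGeometric_three`'s binder `hCg` for this lineage, constants uniform in `(rr, i, n)` once the letters are.
Provenance: seat b2b-balaban-gan24-formalise-leaf-02 gen 49 (prover-…-leaf-02-g49-0), 2026-08-21; over the files named above BY NAME.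
-/

noncomputable section

open Finset
open scoped BigOperators
open Literature.MathematicalPhysics.QuantumFieldTheory
open Literature.MathematicalPhysics.QuantumFieldTheory.LatticeForm (quo)
open Literature.MathematicalPhysics.QuantumFieldTheory.Balaban1983to89
open Literature.MathematicalPhysics.QuantumFieldTheory.Balaban1983to89.Beta
open B4ContourShift (supNorm supNorm_nonneg)
open B12Sec2to5 (l1 l1_nonneg)
open ExpKernelCalculus (MKer Zl Zl_nonneg)
open AffineAveraging (Form0 Form1 Site box toSite unitVec dz)
open AveragingContours (blk)
open AveragingHessianKernels (ell)
open AveragingHessianKernelsRooted (hessFFAt)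
open OneStepResolventKernel (Fib)
open InterLevelTransport (SLam)
open KernelWard (divV)
open KKTFluctuationKernel (delta1)
open BalabanCompositeJets (respStep)
open Summit.QuantumFields.BalabanUV.Beta.AxialProjectorBlockMean (bmGaugeAt)
open Summit.QuantumFields.BalabanUV.Beta.GAN24.RespStepBmDecompLegs (legAct)
open Summit.QuantumFields.BalabanUV.Beta.GAN24.RespStepBmDecompPsi (Psi)
open Summit.QuantumFields.BalabanUV.Beta.GAN24.RespStepBmDecompExact (respStepBmSeq)
open Summit.QuantumFields.BalabanUV.Beta.GAN24.Push4Iter (legChain)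
open Summit.QuantumFields.BalabanUV.Beta.GAN24.Push3 (push₃ isFF_push₃)
open Summit.QuantumFields.BalabanUV.Beta.GAN24.Push3LegTelescope (abs_le_of_env' summable_of_env')
open Summit.QuantumFields.BalabanUV.Beta.GAN24.ContactGaugeStaircase (gauge_eq_staircase abs_gaugePiece_le)
open Summit.QuantumFields.BalabanUV.Beta.GAN24.ContactLambdaCellBound (exp_env_mono_rate exp_supNorm_add_le_exp_l1)
open Summit.QuantumFields.BalabanUV.Beta.GAN24.ContactLambdaEntryBound (abs_contact_entry_le)

namespace Summit.QuantumFields.BalabanUV.Beta.GAN24.BornLambdaContactLineage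

variable {Lc : ℕ} [NeZero Lc]

/-! ## §1 Power algebra: the weight against the letters' powers; the cell polynomial -/

/-- [folklore] **THE UNIT COUNT** (`(k−i)·N^{D−5}` at `D = 4`, `N = Lc^{n+1}`): at the pin `|cE| ≤ Lc^4`,
`|cE·Lc^8|^{n+1}·((Lc^n)^7)⁻¹·(((Lc^{5(n+1)})⁻¹)²·(Lc^n)^4) ≤ Lc^3·(Lc⁻¹)^{n+1}` (weight `N^{12}`, tent `N′^{−7}`, two legs `N^{−5}` each, free block sum `N′^4`, `N′ = N∕Lc`). -/
theorem units_le {cE : ℝ} (hcE : |cE| ≤ (Lc : ℝ) ^ 4) (n : ℕ) :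
    |cE * (Lc : ℝ) ^ (2 * (3 + 1))| ^ (n + 1) * ((((Lc : ℝ) ^ n) ^ (2 * 3 + 1))⁻¹ * ((((Lc : ℝ) ^ (5 * (n + 1)))⁻¹) ^ 2 * (((Lc ^ n : ℕ) : ℝ)) ^ (3 + 1)))
      ≤ (Lc : ℝ) ^ 3 * ((Lc : ℝ)⁻¹) ^ (n + 1) := by
  have hL : (0 : ℝ) < (Lc : ℝ) := Nat.cast_pos.2 (Nat.pos_of_ne_zero (NeZero.ne Lc))
  set q : ℝ := (Lc : ℝ) ^ n with hq
  have hq0 : 0 < q := pow_pos hL n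
  -- every power through `q = Lc^n`
  have e1 : ((Lc ^ n : ℕ) : ℝ) = q := by push_cast; rfl
  have e2 : (Lc : ℝ) ^ (5 * (n + 1)) = (Lc : ℝ) ^ 5 * q ^ 5 := by
    rw [pow_mul, pow_succ, ← pow_mul, mul_comm 5 n, pow_mul, ← hq, mul_comm]
  have e3 : ((Lc : ℝ)⁻¹) ^ (n + 1) = ((Lc : ℝ) * q)⁻¹ := by rw [inv_pow, pow_succ, ← hq, mul_comm]
  have hw : |cE * (Lc : ℝ) ^ (2 * (3 + 1))| ^ (n + 1) ≤ ((Lc : ℝ) ^ 12) ^ (n + 1) := by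
    refine pow_le_pow_left₀ (abs_nonneg _) ?_ _
    rw [abs_mul, abs_of_nonneg (by positivity : (0 : ℝ) ≤ (Lc : ℝ) ^ (2 * (3 + 1)))]
    calc |cE| * (Lc : ℝ) ^ (2 * (3 + 1)) ≤ (Lc : ℝ) ^ 4 * (Lc : ℝ) ^ (2 * (3 + 1)) := mul_le_mul_of_nonneg_right hcE (by positivity)
      _ = (Lc : ℝ) ^ 12 := by rw [← pow_add]
  have e4 : ((Lc : ℝ) ^ 12) ^ (n + 1) = (Lc : ℝ) ^ 12 * q ^ 12 := by rw [pow_succ, ← pow_mul, mul_comm 12 n, pow_mul, ← hq, mul_comm]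
  have hrest : 0 ≤ ((q ^ (2 * 3 + 1))⁻¹ * ((((Lc : ℝ) ^ 5 * q ^ 5)⁻¹) ^ 2 * q ^ (3 + 1))) := by positivity
  rw [e1, e2, e3]
  calc |cE * (Lc : ℝ) ^ (2 * (3 + 1))| ^ (n + 1) * ((q ^ (2 * 3 + 1))⁻¹ * ((((Lc : ℝ) ^ 5 * q ^ 5)⁻¹) ^ 2 * q ^ (3 + 1)))
      ≤ ((Lc : ℝ) ^ 12 * q ^ 12) * ((q ^ (2 * 3 + 1))⁻¹ * ((((Lc : ℝ) ^ 5 * q ^ 5)⁻¹) ^ 2 * q ^ (3 + 1))) := by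
        rw [← e4]; exact mul_le_mul_of_nonneg_right hw hrest
    _ = (Lc : ℝ) ^ 3 * ((Lc : ℝ) * q)⁻¹ := by field_simp; ring

omit [NeZero Lc] in
/-- [folklore] **THE CELL POLYNOMIAL** of PART 3 §4 at `K_B = C₁·X⁻¹`, `α_g = 8·Lc·C₁·X⁻¹` (`X = Lc^{5(n+1)}`):
`2K_B(4α_g + 2α_g·Lc·n) + (8α_g² + 2·(6α_g²)·Lc·n) ≤ C₁²·(X⁻¹)²·((n+1)·(Lc·(64 + 544·Lc + 768·Lc²)))`. -/
theorem polyS_le {C₁ X : ℝ} (hX : 0 < X) (n : ℕ) :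
    2 * (C₁ * X⁻¹) * (4 * (8 * (Lc : ℝ) * C₁ * X⁻¹) + 2 * (8 * (Lc : ℝ) * C₁ * X⁻¹) * Lc * n)
        + (8 * (8 * (Lc : ℝ) * C₁ * X⁻¹) ^ 2 + 2 * (6 * (8 * (Lc : ℝ) * C₁ * X⁻¹) ^ 2) * Lc * n)
      ≤ C₁ ^ 2 * (X⁻¹) ^ 2 * (((n : ℝ) + 1) * ((Lc : ℝ) * (64 + 544 * Lc + 768 * (Lc : ℝ) ^ 2))) := by
  have hL : (0 : ℝ) ≤ (Lc : ℝ) := Nat.cast_nonneg _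
  have hn : (0 : ℝ) ≤ n := Nat.cast_nonneg _
  have hXi : 0 ≤ X⁻¹ := inv_nonneg.2 hX.le
  have hA : 0 ≤ C₁ ^ 2 * (X⁻¹) ^ 2 := by positivity
  -- exact expansion, then `n ≤ n+1`, `1 ≤ n+1`
  have e : 2 * (C₁ * X⁻¹) * (4 * (8 * (Lc : ℝ) * C₁ * X⁻¹) + 2 * (8 * (Lc : ℝ) * C₁ * X⁻¹) * Lc * n)
        + (8 * (8 * (Lc : ℝ) * C₁ * X⁻¹) ^ 2 + 2 * (6 * (8 * (Lc : ℝ) * C₁ * X⁻¹) ^ 2) * Lc * n)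
      = C₁ ^ 2 * (X⁻¹) ^ 2 * (64 * Lc + 512 * (Lc : ℝ) ^ 2 + (32 * (Lc : ℝ) ^ 2 + 768 * (Lc : ℝ) ^ 3) * n) := by ring
  rw [e]
  refine mul_le_mul_of_nonneg_left ?_ hA
  nlinarith [mul_nonneg hL hn, mul_nonneg (mul_nonneg hL hL) hn, mul_nonneg (mul_nonneg (mul_nonneg hL hL) hL) hn, mul_nonneg hL hL,
    mul_nonneg (mul_nonneg hL hL) hL]

/-! ## §2 The weighted contact entry of one Λ lineage -/

section Lineage

variable {rr : Fin (3 + 1) → ℕ} {i n : ℕ} {cE : ℝ} {C₁ κ₁ KE κE Clam Cc δc Tb δK : ℝ}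
  {c : Fin (3 + 1) → (Fin (3 + 1) → ℤ) → Fin (3 + 1) → (Fin (3 + 1) → ℤ) → ℝ}

/-- NOT IN PRINT; OUR PROOF ATTEMPT of the count BORNSEC-PLAN v1.1 §0 (c) (`(k−i)·N^{D−5}`, `D = 4`) for ONE Λ lineage, every letter a HYPOTHESIS with explicit constants.
**THE WEIGHTED CONTACT ENTRY OF ONE Λ LINEAGE** (`d = 3`, `2 ≤ Lc`, in-block root; birth level `i`, `n+1` levels up): legs `T_i = legChain (respStepBmSeq ρ Lc) i n` (dressed envelope
`K_E, κ_E`) and `B_i = respStep (Lc^i) (Lc^{i+n+1})` ((N1) raw letter `C₁, κ₁`), the route's bond gauge functions (sup `C_λ`; staircase by `gauge_eq_staircase`, localised pieces by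
`abs_gaugePiece_le`), a coefficient family `c` under decay `C_c, δ_c`, transversality, and the BRACKET letter `T_b·((Lc^n)^7)⁻¹·e^{−δ_K‖quo (Lc^n) y − u′‖∞}`; weight `(cE·Lc^8)^{n+1}`,
`|cE| ≤ Lc^4`.  THEN, with `κ = min δ_K κ₁`, for ALL `κ′ u′ x z a b`:
`|(cE·Lc^8)^{n+1}·(push₃ T_i T_i T_i (SLam Lc c H_ρ) κ′u′ x z a b − push₃ B_i B_i B_i (SLam Lc c H_ρ) κ′u′ x z a b)| ≤ C_fin·((n+1)·(Lc⁻¹)^{n+1})·e^{−(κ∕48)(|x−u′|₁ + |z−u′|₁)}`,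
`C_fin = Lc^3·((2Lc^4)⁻¹·(4·T_b·(e^{8κ})²·Cnt)·(C₁²·(Lc·(64 + 544Lc + 768Lc²)))·Zl 4 (κ∕16))` — PART 3 §4 on the `inl∕inl` block, `isFF_push₃` on the others, §1 for the powers. -/
theorem abs_weight_mul_contact_le_three (hLc : 2 ≤ Lc) (hrr : rr ∈ box (3 + 1) Lc) (hcE : |cE| ≤ (Lc : ℝ) ^ 4)
    (hN1 : ∀ (m k : ℕ) (μ : Fin (3 + 1)) (z : Site (3 + 1)) (l'' : Fin (3 + 1)) (w' : Site (3 + 1)),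
      |respStep (d := 3) (Lc ^ m) (Lc ^ (m + k + 1)) μ z l'' w'| ≤
        C₁ * ((Lc : ℝ) ^ (5 * (k + 1)))⁻¹ * Real.exp (-(κ₁ * supNorm (quo (Lc ^ (k + 1)) w' - z))))
    (hκ₁ : 0 < κ₁) (hC₁ : 0 ≤ C₁)
    (hE : ∀ μ z l u, |legChain (respStepBmSeq (d := 3) (toSite rr) Lc) i n μ z l u| ≤ KE * Real.exp (-(κE * supNorm (quo (Lc ^ (n + 1)) u - z))))
    (hκE : 0 < κE)
    (hlam : ∀ μ z u, |(Psi (toSite rr) Lc i n (delta1 μ z) - bmGaugeAt (toSite rr) (respStep (d := 3) (Lc ^ i) (Lc ^ (i + n + 1)) μ z) Lc) u| ≤ Clam)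
    (hc : ∀ μ y l u, |c μ y l u| ≤ Cc * Real.exp (-δc * l1 ((Lc : ℤ) • y - u))) (hδc : 0 < δc) (hCc : 0 ≤ Cc)
    (hdiv : ∀ u, divV (SLam Lc c (fun μ y => hessFFAt (toSite rr) Lc μ y)) u = 0)
    (hbr : ∀ (κ' : Fin (3 + 1)) (u' : Site (3 + 1)) μ y, |∑' u, ∑ l, legChain (respStepBmSeq (d := 3) (toSite rr) Lc) i n κ' u' l u * c μ y l u|
      ≤ Tb * ((((Lc : ℝ) ^ n) ^ (2 * 3 + 1))⁻¹) * Real.exp (-(δK * supNorm (quo (Lc ^ n) y - u'))))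
    (hδK : 0 < δK) (hTb : 0 ≤ Tb)
    (κ' : Fin (3 + 1)) (u' x z : Site (3 + 1)) (a b : Fib 3) :
    |(cE * (Lc : ℝ) ^ (2 * (3 + 1))) ^ (n + 1) *
        (push₃ (legChain (respStepBmSeq (d := 3) (toSite rr) Lc) i n) (legChain (respStepBmSeq (d := 3) (toSite rr) Lc) i n)
            (legChain (respStepBmSeq (d := 3) (toSite rr) Lc) i n) (SLam Lc c (fun μ y => hessFFAt (toSite rr) Lc μ y)) κ' u' x z a b
          - push₃ (respStep (d := 3) (Lc ^ i) (Lc ^ (i + n + 1))) (respStep (d := 3) (Lc ^ i) (Lc ^ (i + n + 1)))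
            (respStep (d := 3) (Lc ^ i) (Lc ^ (i + n + 1))) (SLam Lc c (fun μ y => hessFFAt (toSite rr) Lc μ y)) κ' u' x z a b)|
      ≤ ((Lc : ℝ) ^ 3 * ((2 * (Lc : ℝ) ^ (3 + 1))⁻¹ * (((3 : ℝ) + 1) * Tb * (Real.exp (2 * ((3 : ℝ) + 1) * min δK κ₁) ^ 2 *
              (((2 * Lc : ℕ) : ℝ) ^ (3 + 1) * (((3 + 1 : ℕ) : ℝ) * ((Lc : ℝ) ^ (3 + 1) * (ell (3 + 1) Lc : ℝ))))))
            * (C₁ ^ 2 * ((Lc : ℝ) * (64 + 544 * Lc + 768 * (Lc : ℝ) ^ 2))) * Zl (3 + 1) (min δK κ₁ / (4 * ((3 : ℝ) + 1)))))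
          * ((((n : ℝ) + 1)) * ((Lc : ℝ)⁻¹) ^ (n + 1))
          * Real.exp (-(min δK κ₁ / 12 / ((3 : ℝ) + 1)) * (l1 (x - u') + l1 (z - u'))) := by
  have hLc1 : 1 ≤ Lc := le_trans (by norm_num) hLc
  have hL : (0 : ℝ) < (Lc : ℝ) := Nat.cast_pos.2 (Nat.pos_of_ne_zero (NeZero.ne Lc))
  have hLn1 : 1 ≤ Lc ^ (n + 1) := Nat.one_le_pow _ _ hLc1
  set κ : ℝ := min δK κ₁ with hκdef
  have hκ : 0 < κ := lt_min hδK hκ₁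
  have hκK : κ ≤ δK := min_le_left _ _
  have hκ1 : κ ≤ κ₁ := min_le_right _ _
  -- the letters at the common rate `κ`
  set T := legChain (respStepBmSeq (d := 3) (toSite rr) Lc) i n with hTdef
  set B := respStep (d := 3) (Lc ^ i) (Lc ^ (i + n + 1)) with hBdef
  have hT : ∀ μ z' l u, |T μ z' l u| ≤ KE := abs_le_of_env' hκE.le hE
  have hTs : ∀ μ z' l, Summable fun u => T μ z' l u := summable_of_env' hLn1 hκE hE
  have hB : ∀ μ z' l u, |B μ z' l u| ≤ C₁ * ((Lc : ℝ) ^ (5 * (n + 1)))⁻¹ * Real.exp (-(κ * supNorm (quo (Lc ^ (n + 1)) u - z'))) := by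
    intro μ z' l u
    refine (hN1 i n μ z' l u).trans (mul_le_mul_of_nonneg_left (exp_env_mono_rate hκ1 (supNorm_nonneg _)) (by positivity))
  -- the gauge functions and their staircase pieces, as local names (first-order unification in PART 3)
  set lam : Fin (3 + 1) → Site (3 + 1) → Site (3 + 1) → ℝ := fun μ z' =>
    Psi (toSite rr) Lc i n (delta1 μ z') - bmGaugeAt (toSite rr) (respStep (d := 3) (Lc ^ i) (Lc ^ (i + n + 1)) μ z') Lc with hlamdef
  set Gp : Fin (3 + 1) → Site (3 + 1) → ℕ → Site (3 + 1) → ℝ := fun μ₀ z₀ s y =>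
    if s = 0 then -bmGaugeAt (toSite rr) (respStep (d := 3) (Lc ^ i) (Lc ^ (i + n + 1)) μ₀ z₀) Lc y
    else -(((Lc : ℝ) ^ ((3 + 1) * s))⁻¹ *
      bmGaugeAt (toSite rr) (legAct (respStep (d := 3) (Lc ^ (i + s)) (Lc ^ (i + n + 1))) (delta1 μ₀ z₀)) Lc y) with hGpdef
  have hTB : T - B = fun μ z' l u => dz (lam μ z') l u := by
    have hik : i < i + n + 1 := by omega
    have h := BornLambdaLineage.legChain_sub_respStep_of_lt (d := 3) (Lc := Lc) hrr hik
    rw [show i + n + 1 - 1 - i = n by omega] at h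
    exact h
  have hψ : ∀ (μ₀ : Fin (3 + 1)) (z₀ u : Site (3 + 1)), lam μ₀ z₀ u = ∑ s ∈ Finset.range (n + 1), Gp μ₀ z₀ s (blk (Lc ^ s) u) := by
    intro μ₀ z₀ u
    have h := gauge_eq_staircase (Lc := Lc) (toSite rr) i n μ₀ z₀ u
    simp only [hlamdef, hGpdef, Pi.sub_apply] at h ⊢
    exact h
  have hG : ∀ (μ₀ : Fin (3 + 1)) (z₀ : Site (3 + 1)) (s : ℕ), s ≤ n → ∀ u : Site (3 + 1),
      |Gp μ₀ z₀ s (blk (Lc ^ s) u)| ≤ (8 * (Lc : ℝ) * C₁ * ((Lc : ℝ) ^ (5 * (n + 1)))⁻¹) * (Lc : ℝ) ^ s * Real.exp (-(κ * supNorm (quo (Lc ^ (n + 1)) u - z₀))) := by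
    intro μ₀ z₀ s hs u
    have h := abs_gaugePiece_le (Lc := Lc) hN1 hrr i n μ₀ z₀ hs u
    simp only [hGpdef] at h ⊢
    refine h.trans (mul_le_mul_of_nonneg_left (exp_env_mono_rate hκ1 (supNorm_nonneg _)) (by positivity))
  have hbr' : ∀ (κ' : Fin (3 + 1)) (u' : Site (3 + 1)) μ y, |∑' u, ∑ l, T κ' u' l u * c μ y l u|
      ≤ (Tb * ((((Lc : ℝ) ^ n) ^ (2 * 3 + 1))⁻¹)) * Real.exp (-(κ * supNorm (quo (Lc ^ n) y - u'))) := fun κ' u' μ y =>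
    (hbr κ' u' μ y).trans (mul_le_mul_of_nonneg_left (exp_env_mono_rate hκK (supNorm_nonneg _)) (by positivity))
  -- the `inl∕inl` block by PART 3 §4; the others vanish
  have hS := isFF_push₃ (l := T) (r := T) (w := T) (SLam Lc c (fun μ y => hessFFAt (toSite rr) Lc μ y)) κ' u'
  have hS' := isFF_push₃ (l := B) (r := B) (w := B) (SLam Lc c (fun μ y => hessFFAt (toSite rr) Lc μ y)) κ' u'
  have hRHS0 : 0 ≤ ((Lc : ℝ) ^ 3 * ((2 * (Lc : ℝ) ^ (3 + 1))⁻¹ * (((3 : ℝ) + 1) * Tb * (Real.exp (2 * ((3 : ℝ) + 1) * κ) ^ 2 *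
              (((2 * Lc : ℕ) : ℝ) ^ (3 + 1) * (((3 + 1 : ℕ) : ℝ) * ((Lc : ℝ) ^ (3 + 1) * (ell (3 + 1) Lc : ℝ))))))
            * (C₁ ^ 2 * ((Lc : ℝ) * (64 + 544 * Lc + 768 * (Lc : ℝ) ^ 2))) * Zl (3 + 1) (κ / (4 * ((3 : ℝ) + 1)))))
          * ((((n : ℝ) + 1)) * ((Lc : ℝ)⁻¹) ^ (n + 1))
          * Real.exp (-(κ / 12 / ((3 : ℝ) + 1)) * (l1 (x - u') + l1 (z - u'))) := by
    have hz : 0 ≤ Zl (3 + 1) (κ / (4 * ((3 : ℝ) + 1))) := Zl_nonneg (by positivity)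
    positivity
  rcases a with α | μa
  · rcases b with β | νb
    · -- the cells
      have hmain := abs_contact_entry_le (d := 3) (Lc := Lc) (rr := rr) (n := n)
        (αg := 8 * (Lc : ℝ) * C₁ * ((Lc : ℝ) ^ (5 * (n + 1)))⁻¹) (KB := C₁ * ((Lc : ℝ) ^ (5 * (n + 1)))⁻¹)
        (Tb := Tb * ((((Lc : ℝ) ^ n) ^ (2 * 3 + 1))⁻¹)) (lam := lam) (G := Gp) hLc1 hrr hκ (by positivity) (by positivity)
        (by positivity) hc hδc hCc hdiv hT hTs hB hTB hlam hψ hG hbr' κ' u' x z α β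
      rw [abs_mul]
      have hw0 : 0 ≤ |cE * (Lc : ℝ) ^ (2 * (3 + 1))| ^ (n + 1) := pow_nonneg (abs_nonneg _) _
      rw [abs_pow]
      refine (mul_le_mul_of_nonneg_left hmain hw0).trans ?_
      -- the polynomial, the powers, sup → ℓ¹
      have hX : (0 : ℝ) < (Lc : ℝ) ^ (5 * (n + 1)) := by positivity
      have hP := polyS_le (Lc := Lc) (C₁ := C₁) hX n
      have hU := units_le (Lc := Lc) hcE n
      have hexp := exp_supNorm_add_le_exp_l1 (d := 3) (c := κ / 12) (by positivity) (x - u') (z - u')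
      have hZ : 0 ≤ Zl (3 + 1) (κ / (4 * ((3 : ℝ) + 1))) := Zl_nonneg (by positivity)
      -- regroup the PART 3 bound as (weight-free constant) × (powers) × (polynomial) × exp
      have hE0 : 0 ≤ Real.exp (2 * ((3 : ℝ) + 1) * κ) ^ 2 *
          (((2 * Lc : ℕ) : ℝ) ^ (3 + 1) * (((3 + 1 : ℕ) : ℝ) * ((Lc : ℝ) ^ (3 + 1) * (ell (3 + 1) Lc : ℝ)))) := by positivity
      set E2C : ℝ := Real.exp (2 * ((3 : ℝ) + 1) * κ) ^ 2 *
          (((2 * Lc : ℕ) : ℝ) ^ (3 + 1) * (((3 + 1 : ℕ) : ℝ) * ((Lc : ℝ) ^ (3 + 1) * (ell (3 + 1) Lc : ℝ)))) with hE2C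
      set Z : ℝ := Zl (3 + 1) (κ / (4 * ((3 : ℝ) + 1))) with hZdef
      set S : ℝ := 2 * (C₁ * ((Lc : ℝ) ^ (5 * (n + 1)))⁻¹) * (4 * (8 * (Lc : ℝ) * C₁ * ((Lc : ℝ) ^ (5 * (n + 1)))⁻¹)
            + 2 * (8 * (Lc : ℝ) * C₁ * ((Lc : ℝ) ^ (5 * (n + 1)))⁻¹) * Lc * n)
          + (8 * (8 * (Lc : ℝ) * C₁ * ((Lc : ℝ) ^ (5 * (n + 1)))⁻¹) ^ 2 + 2 * (6 * (8 * (Lc : ℝ) * C₁ * ((Lc : ℝ) ^ (5 * (n + 1)))⁻¹) ^ 2) * Lc * n)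
        with hSdef
      set W : ℝ := |cE * (Lc : ℝ) ^ (2 * (3 + 1))| ^ (n + 1) with hWdef
      set EX : ℝ := Real.exp (-(κ / 12) * (supNorm (x - u') + supNorm (z - u'))) with hEX
      set EX' : ℝ := Real.exp (-(κ / 12 / ((3 : ℝ) + 1)) * (l1 (x - u') + l1 (z - u'))) with hEX'
      have hS0 : 0 ≤ S := by rw [hSdef]; positivity
      have hW0 : 0 ≤ W := hw0
      have hEX0 : 0 ≤ EX := (Real.exp_pos _).le
      -- W · [(2Lc^4)⁻¹ · ((4·Tb·q7⁻¹·E2C) · S · (Q4·Z) · EX)] ≤ …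
      have step1 : W * ((2 * (Lc : ℝ) ^ (3 + 1))⁻¹ * ((((3 : ℝ) + 1) * (Tb * ((((Lc : ℝ) ^ n) ^ (2 * 3 + 1))⁻¹)) * E2C) * S
            * ((((Lc ^ n : ℕ) : ℝ)) ^ (3 + 1) * Z) * EX))
          ≤ W * ((2 * (Lc : ℝ) ^ (3 + 1))⁻¹ * ((((3 : ℝ) + 1) * (Tb * ((((Lc : ℝ) ^ n) ^ (2 * 3 + 1))⁻¹)) * E2C)
            * (C₁ ^ 2 * (((Lc : ℝ) ^ (5 * (n + 1)))⁻¹) ^ 2 * (((n : ℝ) + 1) * ((Lc : ℝ) * (64 + 544 * Lc + 768 * (Lc : ℝ) ^ 2))))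
            * ((((Lc ^ n : ℕ) : ℝ)) ^ (3 + 1) * Z) * EX')) := by
        refine mul_le_mul_of_nonneg_left (mul_le_mul_of_nonneg_left ?_ (by positivity)) hW0
        have h1 : 0 ≤ (((3 : ℝ) + 1) * (Tb * ((((Lc : ℝ) ^ n) ^ (2 * 3 + 1))⁻¹)) * E2C) := by positivity
        have h2 : 0 ≤ ((((Lc ^ n : ℕ) : ℝ)) ^ (3 + 1) * Z) := by positivity
        calc (((3 : ℝ) + 1) * (Tb * ((((Lc : ℝ) ^ n) ^ (2 * 3 + 1))⁻¹)) * E2C) * S * ((((Lc ^ n : ℕ) : ℝ)) ^ (3 + 1) * Z) * EX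
            ≤ (((3 : ℝ) + 1) * (Tb * ((((Lc : ℝ) ^ n) ^ (2 * 3 + 1))⁻¹)) * E2C)
              * (C₁ ^ 2 * (((Lc : ℝ) ^ (5 * (n + 1)))⁻¹) ^ 2 * (((n : ℝ) + 1) * ((Lc : ℝ) * (64 + 544 * Lc + 768 * (Lc : ℝ) ^ 2))))
              * ((((Lc ^ n : ℕ) : ℝ)) ^ (3 + 1) * Z) * EX := by gcongr
          _ ≤ _ := mul_le_mul_of_nonneg_left hexp (by positivity)
      have hEX'0 : 0 ≤ EX' := (Real.exp_pos _).le
      refine (le_of_eq ?_).trans (step1.trans ?_)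
      · rw [hSdef, hE2C, hZdef, hEX]; ring
      · -- the powers `W·((Lc^n)^7)⁻¹·((Lc^{5(n+1)})⁻¹)²·(Lc^n)^4 ≤ Lc^3·(Lc⁻¹)^{n+1}` (`units_le`) against the nonnegative rest
        have hR0 : 0 ≤ (2 * (Lc : ℝ) ^ (3 + 1))⁻¹ * ((((3 : ℝ) + 1) * Tb * E2C) * (C₁ ^ 2 * ((Lc : ℝ) * (64 + 544 * Lc + 768 * (Lc : ℝ) ^ 2))) * Z)
            * (((n : ℝ) + 1)) * EX' := by positivity
        calc W * ((2 * (Lc : ℝ) ^ (3 + 1))⁻¹ * ((((3 : ℝ) + 1) * (Tb * ((((Lc : ℝ) ^ n) ^ (2 * 3 + 1))⁻¹)) * E2C)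
            * (C₁ ^ 2 * (((Lc : ℝ) ^ (5 * (n + 1)))⁻¹) ^ 2 * (((n : ℝ) + 1) * ((Lc : ℝ) * (64 + 544 * Lc + 768 * (Lc : ℝ) ^ 2))))
            * ((((Lc ^ n : ℕ) : ℝ)) ^ (3 + 1) * Z) * EX'))
            = (W * (((((Lc : ℝ) ^ n) ^ (2 * 3 + 1))⁻¹ * ((((Lc : ℝ) ^ (5 * (n + 1)))⁻¹) ^ 2 * (((Lc ^ n : ℕ) : ℝ)) ^ (3 + 1)))))
              * ((2 * (Lc : ℝ) ^ (3 + 1))⁻¹ * ((((3 : ℝ) + 1) * Tb * E2C) * (C₁ ^ 2 * ((Lc : ℝ) * (64 + 544 * Lc + 768 * (Lc : ℝ) ^ 2))) * Z)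
                * (((n : ℝ) + 1)) * EX') := by ring
          _ ≤ ((Lc : ℝ) ^ 3 * ((Lc : ℝ)⁻¹) ^ (n + 1))
              * ((2 * (Lc : ℝ) ^ (3 + 1))⁻¹ * ((((3 : ℝ) + 1) * Tb * E2C) * (C₁ ^ 2 * ((Lc : ℝ) * (64 + 544 * Lc + 768 * (Lc : ℝ) ^ 2))) * Z)
                * (((n : ℝ) + 1)) * EX') := mul_le_mul_of_nonneg_right hU hR0
          _ = _ := by ring
    · -- `b = inr`: both tables are ff-valued
      rw [hS.2 x z (Sum.inl α) νb, hS'.2 x z (Sum.inl α) νb, sub_self, mul_zero, abs_zero]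
      exact hRHS0
  · rw [hS.1 x z μa b, hS'.1 x z μa b, sub_self, mul_zero, abs_zero]
    exact hRHS0

end Lineage

end Summit.QuantumFields.BalabanUV.Beta.GAN24.BornLambdaContactLineage

end
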